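import Summits.QuantumFields.YangMills.Theorems.BalabanUVNodesK1EndExactRowsContFreeStep

/-!
# THE STEP WITNESS CROSSES: NON-CROSSING (`hord`) IS NOT NEEDED FOR THE END EITHER — two in-window runs from different bare couplings MEET, at EVERY level

Cell `pub-ymgap`, seat `pub-ymgap-dag-n13-w5` (g6), N13 [B16] width seat; `--kind proof --supports stmt-QuantumFields-27364 --as helper` (K1⁹
`…Theses.BalabanUVNodes.StabilityBRunRowsAtRecordR13SepCoPHV`, crux r3 DECIDING, route rev 29).  Sequel of FILE 5 of the `dag-n13-w4` END-EXACTNESS census (p639689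
`…K1EndExactRowsContFreeStep`, this seat, on n13-w4 g8's hand-out word): there the STEP family `β k v = 𝟙[v 0 < c k]`, `c_k = 1∕(k+2)`, carries END, (W), (T), rows (i)(iv) and no-shrink
at every level while run-wise (C) `SurvCont` fails at every level, and its header SAYS that non-crossing fails too.  THIS FILE makes that sentence a theorem (split off for the 400-line lint).

File 12's β-bound-free END criterion (p621368 `…K1EndCriterionCeilingFree` :172 `endpointExistence_iff_windowRuns_topRuns`) proves NECESSITY `EndpointExistence → (W) ∧ (T)` under TWO
auxiliary hypotheses: survivor continuity `SurvCont β γ₀` and the ORDER LETTER `hord` («in-window runs of (0.20) with `gs 0 < gs' 0` stay strictly ordered at every step», :151 ∕ :174).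
HERE: for the step family `hord` FAILS at every level `γ₀ > 0` — whenever a threshold of a strictly decreasing sequence sits inside the level's run interval, `0 < c_i ≤ (γ₀⁻² + i)^{−1∕2}`,
the runs of length `i + 1` generated from `x' := (c_i⁻² + 1)^{−1∕2} < x := c_i` both solve (0.20), both stay in `]0, γ₀]`, and MEET at step `i + 1`: `g_{i+1}⁻² = c_i⁻² − i` for both
(below the threshold one more unit step fires and exactly compensates the smaller start; `not_hord_step`).  With FILE 5 (END, (W), (T) at every level; `SurvCont` failing at every
level) the display `end_W_T_without_cont_without_hord`: BOTH auxiliary hypotheses of the necessity half fail while its conclusion AND the END hold — so neither (C) nor non-crossing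
is an END-exact letter; both are devices of that proof (the END-exact content stays {(W), (T)}, p633163 §4 ∕ p621368).

HONEST FRAMING.  [folklore] letter-level real analysis on the recursion (0.20) for an ABSTRACT `HBeta`; NOTHING about `Node00.betaOfRecord₁₃` (print [I] §1 pp. 263–264 asserts smoothness
of the true β-functions in the coupling, where both devices are expected to be available); nothing of Bałaban asserted; no item filed ∕ closed; K1⁹ NOT closed (v10, 0∕6 stubs); N13 NOT
discharged; counts UNMOVED (typed 28∕28 · discharged 5∕27 · A 5∕28).  One finite 𝕋⁴ programme at fixed ε, Bałaban AS PRINTED; R4 = the CONDITIONAL finite-𝕋⁴ rung `BalabanLadder.UV`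
only — the Yang–Mills mass gap (Clay) is NOT proved by any of this; nothing continuum ∕ ℝ⁴ ∕ OS.  No `sorry`, no `axiom`, no `def`, no `instance`, no `notation`.
Sources (context only): [I] T. Bałaban, Commun. Math. Phys. 109 (1987) 249 [Balaban1987RG1] (0.17)–(0.20) pp. 255–256, Thm 2 p. 259 (first sentence), §1 pp. 263–264.
-/

noncomputable section

open scoped BigOperators Matrix.Norms.L2Operator

namespace Summit.QuantumFields.YangMills.Theorems.BalabanUVNodesK1EndExactRowsContFreeStepCrossing

open Literature.MathematicalPhysics.QuantumFieldTheory.Balaban1983to89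
open Literature.MathematicalPhysics.QuantumFieldTheory.Balaban1983to89.FlowStep
open Literature.MathematicalPhysics.QuantumFieldTheory.Balaban1983to89.FlowStepRuns
open Literature.MathematicalPhysics.QuantumFieldTheory.Balaban1983to89.DagBinding
open Summit.QuantumFields.YangMills.Theorems.BalabanUVNodesK2NamedJetsRunRemAt (SurvCont)
open Summit.QuantumFields.YangMills.Theorems.BalabanUVNodesK1EndExactRowsContFreeStep

/-! ## §1 NON-CROSSING FAILS TOO: two in-window runs from different bare couplings MEET — the second auxiliary hypothesis (`hord`) of file 12's necessity half -/

section Hord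

variable {β : HBeta} {c : ℕ → ℝ}

/-- IN-WINDOW FROM THE CLOSED FORM: if `#{i < K : x < c_i} + γ⁻² ≤ x⁻²` then the run generated from `x` stays in `]0, γ]` up to `K` (partial counts only grow). [cite: Balaban1987RG1, (0.18)–(0.20) pp.255–256 (the recursion only; elementary)] -/
theorem inInterval_genSeq_step (hβ : ∀ (k : ℕ) (v : Fin (k + 1) → ℝ), β k v = if v 0 < c k then 1 else 0) {x γ : ℝ} (hx : 0 < x) (hγ : 0 < γ) {K : ℕ}
    (hK : ∑ i ∈ Finset.range K, (if x < c i then (1 : ℝ) else 0) + 1 / γ ^ 2 ≤ 1 / x ^ 2) :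
    Step.InInterval γ K (genSeq β x) := by
  have hK' : ∑ i ∈ Finset.range K, (if x < c i then (1 : ℝ) else 0) < 1 / x ^ 2 := by
    linarith [show (0 : ℝ) < 1 / γ ^ 2 by positivity]
  intro k hk
  obtain ⟨hpos, heq⟩ := inv_sq_genSeq_step hβ hx hK' k hk
  refine ⟨hpos, ?_⟩
  have hle : ∑ i ∈ Finset.range k, (if x < c i then (1 : ℝ) else 0) ≤ ∑ i ∈ Finset.range K, (if x < c i then (1 : ℝ) else 0) :=
    Finset.sum_le_sum_of_subset_of_nonneg (Finset.range_mono hk) fun i _ _ => by split_ifs <;> norm_num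
  have h1 : 1 / γ ^ 2 ≤ 1 / (genSeq β x k) ^ 2 := by
    rw [heq]
    linarith
  have h2 := (one_div_le_one_div (by positivity) (by positivity)).1 h1
  exact (pow_le_pow_iff_left₀ hpos.le hγ.le two_ne_zero).1 h2

/-- at the threshold `x = c_i` of a strictly decreasing threshold sequence exactly the `i` earlier steps fire: `Σ_{j ≤ i} 𝟙[c_i < c_j] = i`. [folklore] -/
theorem sum_step_at_threshold (hc : StrictAnti c) (i : ℕ) :
    ∑ j ∈ Finset.range (i + 1), (if c i < c j then (1 : ℝ) else 0) = i := by
  rw [Finset.sum_range_succ, if_neg (lt_irrefl _), add_zero,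
    Finset.sum_congr rfl fun j hj => if_pos (hc (Finset.mem_range.mp hj)), Finset.sum_const, Finset.card_range, nsmul_eq_mul, mul_one]

/-- just below the threshold all `i + 1` steps fire: `x' < c_i` ⟹ `Σ_{j ≤ i} 𝟙[x' < c_j] = i + 1`. [folklore] -/
theorem sum_step_below_threshold (hc : StrictAnti c) (i : ℕ) {x' : ℝ} (hx' : x' < c i) :
    ∑ j ∈ Finset.range (i + 1), (if x' < c j then (1 : ℝ) else 0) = i + 1 := by
  rw [Finset.sum_congr rfl fun j hj => if_pos (lt_of_lt_of_le hx' (hc.antitone (Nat.lt_succ_iff.mp (Finset.mem_range.mp hj)))),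
    Finset.sum_const, Finset.card_range, nsmul_eq_mul, mul_one, Nat.cast_succ]

/-- ★ **NON-CROSSING FAILS AT LEVEL `γ₀`** whenever a threshold `c_i` of a strictly decreasing sequence sits inside that level's run interval, `0 < c_i ≤ (γ₀⁻² + i)^{−1∕2}`: the runs of
length `i + 1` generated from `x' := (c_i⁻² + 1)^{−1∕2} < x := c_i` both solve (0.20), both stay in `]0, γ₀]`, start strictly ordered and MEET at step `i + 1` (`g_{i+1}⁻² = c_i⁻² − i`
for both: below the threshold one more unit step fires and exactly compensates the smaller start).  So the order hypothesis `hord` of file 12's necessity half (p621368 :151 ∕ :174,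
`topRuns_of_endpointExistence` ∕ `endpointExistence_iff_windowRuns_topRuns`) fails for this family at every level reached by the thresholds — like (C), a device of that proof,
not a letter the END pays (here END, (W), (T) hold regardless, §§1–2). [cite: Balaban1987RG1, Thm 2 p.259 (first sentence), (0.17)–(0.20) pp.255–256 (elementary; nothing of the theorem asserted)] -/
theorem not_hord_step (hβ : ∀ (k : ℕ) (v : Fin (k + 1) → ℝ), β k v = if v 0 < c k then 1 else 0) (hc : StrictAnti c) {γ₀ : ℝ} (hγ₀ : 0 < γ₀) {i : ℕ}
    (hci : 0 < c i) (hci' : c i ≤ 1 / Real.sqrt (1 / γ₀ ^ 2 + i)) :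
    ¬ ∀ γ : ℝ, 0 < γ → γ ≤ γ₀ → ∀ (n : ℕ) (gs gs' : ℕ → ℝ), RGEqH n β gs → RGEqH n β gs' →
      Step.InInterval γ n gs → Step.InInterval γ n gs' → gs 0 < gs' 0 → ∀ k, k ≤ n → gs k < gs' k := by
  intro hord
  -- the threshold inequality in inverse-square form: `γ₀⁻² + i ≤ c_i⁻²`
  have hA : 0 < 1 / γ₀ ^ 2 + i := by positivity
  have hci2 : 1 / γ₀ ^ 2 + i ≤ 1 / (c i) ^ 2 := by
    have h1 : Real.sqrt (1 / γ₀ ^ 2 + i) ≤ 1 / c i := by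
      have := one_div_le_one_div_of_le hci hci'
      rwa [one_div_one_div] at this
    have h2 := pow_le_pow_left₀ (Real.sqrt_nonneg _) h1 2
    rwa [Real.sq_sqrt hA.le, one_div_pow] at h2
  have hγ2 : (0 : ℝ) < 1 / γ₀ ^ 2 := by positivity
  -- the smaller start `x' = (c_i⁻² + 1)^{-1/2}`
  have hB : 0 < 1 / (c i) ^ 2 + 1 := by positivity
  set x' : ℝ := 1 / Real.sqrt (1 / (c i) ^ 2 + 1) with hx'_def
  have hx'0 : 0 < x' := div_pos one_pos (Real.sqrt_pos.mpr hB)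
  have hx'_sq : 1 / x' ^ 2 = 1 / (c i) ^ 2 + 1 := by
    rw [hx'_def, div_pow, one_pow, Real.sq_sqrt hB.le, one_div_one_div]
  have hx'lt : x' < c i := by
    have h : 1 / (c i) ^ 2 < 1 / x' ^ 2 := by rw [hx'_sq]; linarith
    have h2 := (one_div_lt_one_div (by positivity) (by positivity)).1 h
    by_contra hge
    exact absurd (pow_le_pow_left₀ hci.le (not_lt.mp hge) 2) (not_le.mpr h2)
  -- closed-form counts for the two starts
  have hKx : ∑ j ∈ Finset.range (i + 1), (if c i < c j then (1 : ℝ) else 0) < 1 / (c i) ^ 2 := by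
    rw [sum_step_at_threshold hc i]; linarith
  have hKx' : ∑ j ∈ Finset.range (i + 1), (if x' < c j then (1 : ℝ) else 0) < 1 / x' ^ 2 := by
    rw [sum_step_below_threshold hc i hx'lt, hx'_sq]; linarith
  have hIx : Step.InInterval γ₀ (i + 1) (genSeq β (c i)) :=
    inInterval_genSeq_step hβ hci hγ₀ (by rw [sum_step_at_threshold hc i]; linarith)
  have hIx' : Step.InInterval γ₀ (i + 1) (genSeq β x') :=
    inInterval_genSeq_step hβ hx'0 hγ₀ (by rw [sum_step_below_threshold hc i hx'lt, hx'_sq]; linarith)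
  -- the two runs MEET at step `i + 1`
  have hmeet : genSeq β x' (i + 1) = genSeq β (c i) (i + 1) := by
    obtain ⟨hp1, he1⟩ := inv_sq_genSeq_step hβ hx'0 hKx' (i + 1) le_rfl
    obtain ⟨hp2, he2⟩ := inv_sq_genSeq_step hβ hci hKx (i + 1) le_rfl
    rw [sum_step_below_threshold hc i hx'lt, hx'_sq] at he1
    rw [sum_step_at_threshold hc i] at he2
    have h : 1 / (genSeq β x' (i + 1)) ^ 2 = 1 / (genSeq β (c i) (i + 1)) ^ 2 := by rw [he1, he2]; ring
    have h2 : (genSeq β x' (i + 1)) ^ 2 = (genSeq β (c i) (i + 1)) ^ 2 := by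
      have h3 := congrArg (fun t : ℝ => 1 / t) h
      simpa only [one_div_one_div] using h3
    exact (pow_left_inj₀ hp1.le hp2.le two_ne_zero).1 h2
  have h0 : genSeq β x' 0 < genSeq β (c i) 0 := by rw [genSeq_zero, genSeq_zero]; exact hx'lt
  have hlt := hord γ₀ hγ₀ le_rfl (i + 1) (genSeq β x') (genSeq β (c i)) (rgEqH_genSeq_step hβ hx'0 hKx') (rgEqH_genSeq_step hβ hci hKx)
    hIx' hIx h0 (i + 1) le_rfl
  rw [hmeet] at hlt
  exact lt_irrefl _ hlt

end Hord

/-- ★ **(W), (T) AND THE END — WITHOUT (C) AND WITHOUT NON-CROSSING AT ANY LEVEL — KERNEL WITNESS.**  The step family with thresholds `1∕(k+2)`: (W) and (T) at every level and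
`EndpointExistence (modelOf β)`, while BOTH auxiliary hypotheses of file 12's necessity half `EndpointExistence → (W) ∧ (T)` (p621368 :172: `SurvCont β γ₀` and the order letter
`hord`) FAIL at EVERY level `γ₀ > 0`.  So neither (C) nor non-crossing is an END-exact letter; the criterion's conclusion holds here without either.  HONEST SCOPE: letter level only; at the
route's `betaOfRecord₁₃ θ` NOTHING is claimed (print's β is smooth in the coupling, [I] §1, where both devices are expected to be available). [folklore] -/
theorem end_W_T_without_cont_without_hord : ∃ β : HBeta,
    (∀ γ : ℝ, 0 < γ → ∀ K : ℕ, ∃ gs : ℕ → ℝ, RGEqH K β gs ∧ Step.InInterval γ K gs) ∧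
    (∀ γ : ℝ, 0 < γ → ∃ gstar : ℝ, 0 < gstar ∧
      ∀ (n : ℕ) (gs : ℕ → ℝ), RGEqH n β gs → Step.InInterval γ n gs → ∀ k, k ≤ n → gs k = γ → gstar ≤ gs n) ∧
    EndpointExistence (modelOf β) ∧
    (∀ γ₀ : ℝ, 0 < γ₀ → ¬ SurvCont β γ₀) ∧
    (∀ γ₀ : ℝ, 0 < γ₀ → ¬ ∀ γ : ℝ, 0 < γ → γ ≤ γ₀ → ∀ (n : ℕ) (gs gs' : ℕ → ℝ), RGEqH n β gs → RGEqH n β gs' →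
      Step.InInterval γ n gs → Step.InInterval γ n gs' → gs 0 < gs' 0 → ∀ k, k ≤ n → gs k < gs' k) := by
  have hβ : ∀ (k : ℕ) (v : Fin (k + 1) → ℝ),
      (fun k w => if w 0 < 1 / ((k : ℝ) + 2) then 1 else 0 : HBeta) k v = if v 0 < (fun k : ℕ => 1 / ((k : ℝ) + 2)) k then 1 else 0 := fun _ _ => rfl
  have hc : StrictAnti fun k : ℕ => (1 : ℝ) / ((k : ℝ) + 2) := by
    intro a b hab
    have hab' : (a : ℝ) < b := Nat.cast_lt.mpr hab
    show (1 : ℝ) / ((b : ℝ) + 2) < 1 / ((a : ℝ) + 2)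
    exact one_div_lt_one_div_of_lt (by positivity) (by linarith)
  refine ⟨fun k w => if w 0 < 1 / ((k : ℝ) + 2) then 1 else 0, fun γ hγ => step_windowRuns hβ γ γ hγ le_rfl, fun _ hγ => step_topRuns hβ hγ,
    endpointExistence_modelOf_step hβ, fun γ₀ hγ₀ => ?_, fun γ₀ hγ₀ => ?_⟩
  · obtain ⟨k, hk⟩ := exists_scale_step hγ₀
    exact not_survCont_step hβ hγ₀ (k := k) (by positivity) hk
  · obtain ⟨k, hk⟩ := exists_scale_step hγ₀
    exact not_hord_step hβ hc hγ₀ (i := k) (by positivity) hk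

end Summit.QuantumFields.YangMills.Theorems.BalabanUVNodesK1EndExactRowsContFreeStepCrossing

end
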